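import Literature.NumberTheory.EllipticCurves.Selmer
import Literature.NumberTheory.EllipticCurves.BhargavaHo2022.TwoMarkedPoints
import HarnessLib

/-!
# Bhargava–Ho 2022, Thm 1.1(g) with Thm 1.2: the average size of the `2`-Selmer group over any LARGE
# subfamily of `F₂` (elliptic curves with two marked points) is at most `12` — named fact

Topic `Literature/NumberTheory/EllipticCurves`, cluster `BhargavaHo2022` (vocabulary file
`TwoMarkedPoints.lean`: `Params`, `CongruenceFamily₂`, `IsLarge`, `AverageOnLE`; counting facts
`LargeFamilyCount.lean` (`thm9_1_F2`), `LargeFamilyEulerProduct.lean`). This file transcribes ONE further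
named fact of the same paper — the `F₂` clause of Theorem 1.1 in the large-subfamily strengthening of
Theorem 1.2 — which `TwoMarkedPoints.lean` lists under «Not transcribed here (no consumer yet)». CONSUMER
(cell bsd-rank2, seat bsd-rank2-rootno-p2 GEN 5): the door at `p = 2` of route `CountingDoorF2AtThree`,
`Summits/…/Theorems/CountingDoorF2AtThreeWeakLeafAtTwo.lean` (`weakLeafAtTwo_of_selmerTwoAverage_of_neCubeTwo`:
this fact + BH Thm 9.1/10.1 + ONE open level-set input «`dens{#Sel₂ = 8} < 1/2`» ⟹ `rank = 2 ∧ Ш[2^∞] = 0`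
for a positive proportion of every large `Φ ⊆ F₂`), whose hypothesis `hBH` is this fact's body verbatim.

**Source** (held, `paper:arxiv-2207.03309`, LaTeX text; page = chunk p0002): M. Bhargava, W. Ho, *On
average sizes of Selmer groups and ranks in families of elliptic curves having marked points*,
arXiv:2207.03309 (2022) [BhargavaHo2022].
* Thm 1.1 (p0002 L28–L43): "Theorem 1.1. When elliptic curves in the families `F₀, F₁, F₁(3), F₁(2), F₂`
  are ordered by height: … (g) The average size of the `2`-Selmer group in `F₂` is at most `12`."
* (p0002 L47): "For cases (c), (f), and (g), the statement that the average size is at most a given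
  integer `N` means that the limsup of the corresponding ratio is at most `N`."
* Thm 1.2 (p0002 L70–L73): "Theorem 1.2. The average values and upper bounds given in Theorem 1.1 for
  the families `F₀, F₁, F₁(2), F₁(3)`, and `F₂` remain the same even when one averages over any large
  subfamily of one of these families."
So, in the vocabulary of `TwoMarkedPoints.lean` (`Φ.AverageOnLE f c` := «for every `ε > 0`, eventually the
average of `f` over the members of `Φ` of height `< X` is `≤ c + ε`», i.e. `limsup ≤ c`): for every LARGE
subfamily `Φ` of `F₂`, `Φ.AverageOnLE (fun a ↦ #Sel₂(E_a)) 12`.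

## Contents
* named fact `thm1_2_F2_selmerTwo` (nothing asserted). Thm 1.1(g) itself is the instance `Φ = F₂`
  (`CongruenceFamily₂.all`, large by `CongruenceFamily₂.isLarge_all`).

Not transcribed (no consumer): the other six clauses of Thm 1.1 (families `F₀, F₁, F₁(2), F₁(3)`; the
`3`-Selmer averages), the minimal-height variants, Thm 1.3 (average-rank bounds `7/6, 13/6, 7/6, 3/2, 7/2`).
-- TODO(general form): Thm 1.2 is printed for all five families and both Selmer primes of Thm 1.1; only the
-- `F₂` / `2`-Selmer clause (g) is vendored here.
HONEST FRAMING: a PUBLISHED THEOREM taken as a named fact (its proof — counting `2 ⊗ 2 ⊗ 2 ⊗ 2` hypercubes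
with a square-free sieve, §§3–9 of the source — is not formalised); it reads no analytic rank; nothing about
BSD is claimed.

References: [BhargavaHo2022] Thm. 1.1(g), Thm. 1.2 and the sentence after Thm. 1.1 (§1, p. 2);
B. Poonen, E. Rains, J. AMS 25 (2012) (the value `12 = 2²·3` as the Poonen–Rains average for two marked
points) [PoonenRains2012].
-/

namespace Literature.NumberTheory.EllipticCurves.BhargavaHo2022

/-- **Bhargava–Ho 2022, Thm 1.1(g) with Thm 1.2 (`F₂`, `2`-Selmer, large subfamilies).** As printed:
"(g) The average size of the `2`-Selmer group in `F₂` is at most `12`." — "the statement that the average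
size is at most a given integer `N` means that the limsup of the corresponding ratio is at most `N`" —
"Theorem 1.2. The average values and upper bounds given in Theorem 1.1 … remain the same even when one
averages over any large subfamily of one of these families." Transcription: for every large subfamily `Φ`
of `F₂` (Bhargava–Ho's height, `CongruenceFamily₂.IsLarge`), `limsup_X` of the average of `#Sel₂(E_a)` over
the members of `Φ` of height `< X` is at most `12` (`AverageOnLE`, ε-form). Nothing asserted (named fact).
[cite: BhargavaHo2022, Thm. 1.1(g) and Thm. 1.2 (§1, p. 2)] -/
def thm1_2_F2_selmerTwo : Prop :=
  ∀ Φ : CongruenceFamily₂, Φ.IsLarge →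
    Φ.AverageOnLE (fun a ↦ (Nat.card (a.curve.selmerGroup 2) : ℝ)) 12

end Literature.NumberTheory.EllipticCurves.BhargavaHo2022
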